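import Summits.HodgeConjecture.CorCM.Census.CentralSquaresSmallIndex

/-!
# The square-central class, XLVIII: THE ORDER-EIGHT QUOTIENT LAW — every `c`-faithful quotient of order `8` other than `Q₈` closes the row

COR-CM (cell `pub-hodgecm2`), count-neutral kernel combinatorics by the binder seat b09 (gen 49; lane SQUARE-CENTRAL CLASS, part XLVIII), on part XLVII
(`Census/CentralSquaresSmallIndex.lean`: the small-index law and its group-theoretic lemmas), part XLVI (THE DIHEDRAL LAW
`isLeast_card_gfaces_generate_of_surjective_dihedral`), seat b09 gen 44ʼs commutator law and seat b23 gen 54ʼs dihedral-equivalence brick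
(`QuaternionDoubling.dihedralEquiv`) BY NAME.  Theorems only: no definition, no certificate, no named fact, no `sorry`; `decide` only on `DihedralGroup 4`
(inside part XLVII).  HONEST FRAMING: `HC_CM` is NOT proved, here or anywhere in the tree; nothing here is a period or a headline — these are census laws
`μ(G, c)` for the face-relation lattice.

THE SECOND FRONTIER LEMMA.  Part XLVII: a `c`-avoiding subgroup of index `≤ 4` closes the row `(G, c)`.  At index `8` the first case is a NORMAL
`c`-avoiding subgroup `N`, i.e. a `c`-faithful quotient `G/N` of order `8`:

* §1 (group theory, every finite group) `exists_dihedral_surjection_of_card_quotient_eight`: `N ⊴ G`, `c ∉ N` central, `|G/N| = 8`, and an element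
  `w ∉ N` with `w² ∈ N` whose class is NOT central in `G/N` ⟹ a surjection `π : G ↠ D₄` with `π c = r²`.  (The class `w̄` is a non-central involution;
  `G/N` is then neither cyclic nor of exponent `2`, so it has an element `ū` of order `4`; `w̄ ∉ ⟨ū⟩` since the involution `ū²` of `⟨ū⟩` is central;
  `w̄` inverts `ū` since otherwise it would commute with all of `G/N = ⟨ū, w̄⟩`; seat b23ʼs `dihedralEquiv` does the rest, and the non-trivial central
  class `c̄` goes to `r²`.)
* §2 **THE ORDER-EIGHT QUOTIENT LAW** (`isLeast_card_gfaces_generate_of_card_quotient_eight`): `G` a finite `2`-group, `c` a central involution, `N ⊴ G` with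
  `c ∉ N` and `|G/N| = 8`; if `G/N` is abelian, or has a non-central involution, then **`μ(G, c) = φ₂(G, c)`** (commutator law, resp. THE DIHEDRAL LAW
  through §1).  A non-abelian group of order `8` all of whose involutions are central is the quaternion group — so **the only `c`-faithful quotients of
  order `8` of an OPEN row are quaternion** (`Q₈` with `c̄ = −1`), in accordance with the numerics of this generation (all 34 open rows of order `32`:
  their `c`-faithful quotients of order `8` are `Q₈` or absent).

## References
* [Pohlmann1968] H. Pohlmann, Algebraic cycles on abelian varieties of complex multiplication type, Ann. of Math. 88 (1968), Thm 1.
-/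

namespace Summit.HodgeConjecture.CorCM.Census.CentralSquares

open Finset DihedralGroup
open Summit.HodgeConjecture.CorCM.Prior.AllgGroup.RfwfAllgGroup
open Summit.HodgeConjecture.CorCM.Census.BlockParity
open Summit.HodgeConjecture.CorCM.Census.Coinvariant

noncomputable section

/-! ## §1 Group theory: a quotient of order `8` with a non-central involution is dihedral -/

section GroupTheory

variable {K : Type*} [Group K] [Fintype K]

/-- **ORDER-EIGHT QUOTIENTS.**  `N ⊴ G`, `c ∉ N` central, `|G/N| = 8`, and `w ∉ N` with `w² ∈ N` whose class is not central in `G/N` ⟹ there is a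
surjection `π : G ↠ D₄` with `π c = r 2`. [folklore] -/
theorem exists_dihedral_surjection_of_card_quotient_eight {c : K} (hcen : ∀ x : K, x * c = c * x) (N : Subgroup K) [hNn : N.Normal]
    (hcN : c ∉ N) (hcardQ : Nat.card (K ⧸ N) = 8) (w : K) (hwN : w ∉ N) (hwwN : w * w ∈ N)
    (hwz : ∃ g : K, g * w * g⁻¹ * w⁻¹ ∉ N) :
    ∃ π : K →* DihedralGroup 4, Function.Surjective π ∧ π c = r 2 := by
  classical
  let mk : K →* K ⧸ N := QuotientGroup.mk' N
  have hmk : ∀ g : K, mk g = (g : K ⧸ N) := fun g => rfl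
  have hw1 : mk w ≠ 1 := by rw [hmk, Ne, QuotientGroup.eq_one_iff]; exact hwN
  have hww : mk w * mk w = 1 := by rw [← map_mul, hmk, QuotientGroup.eq_one_iff]; exact hwwN
  -- `w̄` is NOT central
  have hwc : ¬ ∀ g : K ⧸ N, g * mk w = mk w * g := by
    intro hall
    obtain ⟨g, hg⟩ := hwz
    apply hg
    rw [← QuotientGroup.eq_one_iff, ← hmk, map_mul, map_mul, map_mul, map_inv, map_inv, hall (mk g), mul_inv_cancel_right, mul_inv_cancel]
  -- an element of order `4` in `G/N` (else `G/N` is cyclic or of exponent `2`, hence abelian)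
  have hex : ∃ u : K ⧸ N, orderOf u = 4 := by
    by_contra hno
    push Not at hno
    have h8 : (Nat.divisors 8) = {1, 2, 4, 8} := by decide
    have hords : ∀ x : K ⧸ N, orderOf x = 1 ∨ orderOf x = 2 ∨ orderOf x = 8 := by
      intro x
      have hd : orderOf x ∈ Nat.divisors 8 := Nat.mem_divisors.2 ⟨hcardQ ▸ orderOf_dvd_natCard x, by norm_num⟩
      rw [h8] at hd
      simp only [Finset.mem_insert, Finset.mem_singleton] at hd
      rcases hd with h | h | h | h
      · exact Or.inl h
      · exact Or.inr (Or.inl h)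
      · exact absurd h (hno x)
      · exact Or.inr (Or.inr h)
    by_cases hcyc : ∃ x : K ⧸ N, orderOf x = 8
    · obtain ⟨x, hx⟩ := hcyc
      have htop : Subgroup.zpowers x = ⊤ := by
        apply Subgroup.eq_top_of_card_eq
        rw [Nat.card_zpowers, hx, hcardQ]
      apply hwc
      intro g
      obtain ⟨a, rfl⟩ := Subgroup.mem_zpowers_iff.mp (htop ▸ Subgroup.mem_top g : g ∈ Subgroup.zpowers x)
      obtain ⟨b, hb⟩ := Subgroup.mem_zpowers_iff.mp (htop ▸ Subgroup.mem_top (mk w) : mk w ∈ Subgroup.zpowers x)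
      rw [← hb]; exact zpow_mul_comm x a b
    · push Not at hcyc
      have hsq : ∀ x : K ⧸ N, x * x = 1 := by
        intro x
        rcases hords x with h | h | h
        · rw [orderOf_eq_one_iff.mp h, mul_one]
        · rw [← pow_two, ← h, pow_orderOf_eq_one]
        · exact absurd h (hcyc x)
      exact hwc fun g => smallIndex_comm_of_mul_self_eq_one hsq g (mk w)
  obtain ⟨u, hu⟩ := hex
  have hindex : (Subgroup.zpowers u).index = 2 := by
    have h := (Subgroup.zpowers u).card_mul_index
    rw [Nat.card_zpowers, hu, hcardQ] at h
    omega
  haveI hun : (Subgroup.zpowers u).Normal := Subgroup.normal_of_index_eq_two hindex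
  -- `w̄ ∉ ⟨ū⟩`: the only involution there is the central `ū²`
  have hw : mk w ∉ Subgroup.zpowers u := by
    intro hmem
    rcases smallIndex_mem_zpowers_of_orderOf_four hu hmem with h | h | h | h
    · exact hw1 h
    · exact smallIndex_sq_ne_one_of_orderOf_four hu (by rw [← h]; exact hww)
    · apply hwc; intro g; rw [h, pow_two]; exact smallIndex_sq_central hu hun g
    · apply smallIndex_sq_ne_one_of_orderOf_four hu
      rw [h, ← mul_inv_rev, inv_eq_one] at hww
      exact hww
  -- `w̄` inverts `ū`: it conjugates `ū` to `ū` or `ū⁻¹`, and the first would make `w̄` central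
  have hwu : mk w * u * (mk w)⁻¹ = u⁻¹ := by
    rcases smallIndex_conj_eq_or hu hun (mk w) with h | h
    · exfalso
      have hcomm : Commute (mk w) u := by
        calc mk w * u = mk w * u * (mk w)⁻¹ * mk w := by rw [inv_mul_cancel_right]
          _ = u * mk w := by rw [h]
      apply hwc
      intro g
      obtain ⟨d, rfl⟩ := QuaternionDoubling.dihedralMap_surjective (n := 4) hu hindex hw g
      cases d with
      | r i => exact ((hcomm.pow_right i.val).symm : Commute (u ^ i.val) (mk w))
      | sr i =>
        change mk w * u ^ i.val * mk w = mk w * (mk w * u ^ i.val)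
        rw [mul_assoc, (hcomm.pow_right i.val).eq]
    · exact h
  -- the dihedral presentation of `G/N` and the surjection
  letI : Fintype (K ⧸ N) := Fintype.ofFinite _
  let e : DihedralGroup 4 ≃* K ⧸ N := QuaternionDoubling.dihedralEquiv hu hindex hw hww hwu
  let π : K →* DihedralGroup 4 := e.symm.toMonoidHom.comp mk
  refine ⟨π, e.symm.surjective.comp (QuotientGroup.mk'_surjective N), ?_⟩
  have hπc : π c = e.symm (mk c) := rfl
  rw [hπc]
  apply smallIndex_dihedral_central_eq_r_two
  · rw [MulEquiv.map_ne_one_iff, hmk, Ne, QuotientGroup.eq_one_iff]; exact hcN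
  · intro y
    obtain ⟨z, rfl⟩ := e.symm.surjective y
    obtain ⟨g, rfl⟩ := QuotientGroup.mk'_surjective N z
    change e.symm (mk g) * e.symm (mk c) = e.symm (mk c) * e.symm (mk g)
    rw [← map_mul, ← map_mul, ← map_mul, ← map_mul, hcen g]

end GroupTheory

/-! ## §2 The order-eight quotient law -/

variable {G : Type*} [Group G] [Fintype G] [DecidableEq G]

/-- **THE ORDER-EIGHT QUOTIENT LAW, dihedral branch.**  `G` a finite `2`-group, `c` a central involution, `N ⊴ G` with `c ∉ N`, `|G/N| = 8`, and an
element `w ∉ N`, `w² ∈ N`, whose class is not central in `G/N` ⟹ **`μ(G, c) = φ₂(G, c)`** (THE DIHEDRAL LAW along `G ↠ G/N ≅ D₄`). [folklore] -/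
theorem isLeast_card_gfaces_generate_of_card_quotient_eight (hG : IsPGroup 2 G) {c : G} (hc2 : c * c = 1) (hcen : ∀ x : G, x * c = c * x)
    (N : Subgroup G) [N.Normal] (hcN : c ∉ N) (hcardQ : Nat.card (G ⧸ N) = 8) (w : G) (hwN : w ∉ N) (hwwN : w * w ∈ N)
    (hwz : ∃ g : G, g * w * g⁻¹ * w⁻¹ ∉ N) :
    IsLeast {n : ℕ | ∃ T : Finset (CMF G c →₀ ℤ), (↑T ⊆ gfaceSet G c hc2) ∧ T.card = n ∧
      hodgeSpan c hc2 ≤ Submodule.span ℤ (pairSet c) ⊔ Submodule.span ℤ (translates c T)} (fibreTwo c hc2) := by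
  obtain ⟨π, hπ, hπc⟩ := exists_dihedral_surjection_of_card_quotient_eight hcen N hcN hcardQ w hwN hwwN hwz
  exact isLeast_card_gfaces_generate_of_surjective_dihedral hG hc2 hcen π hπ hπc

omit [Fintype G] [DecidableEq G] in
/-- An abelian `c`-faithful quotient forces `c ∉ [G, G]`. [folklore] -/
theorem notMem_commutator_of_quotient_comm {c : G} (N : Subgroup G) [N.Normal] (hcN : c ∉ N)
    (hcomm : ∀ a b : G ⧸ N, a * b = b * a) : c ∉ commutator G :=
  fun hc => hcN (smallIndex_commutator_le_of_quotient_comm N hcomm hc)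

/-- **THE ORDER-EIGHT QUOTIENT LAW.**  `G` a finite `2`-group, `c` a central involution, `N ⊴ G` with `c ∉ N` and `|G/N| = 8`.  If `G/N` is abelian,
or some `w ∉ N` with `w² ∈ N` has a non-central class, then **`μ(G, c) = φ₂(G, c)`**; the excluded case is a non-abelian quotient of order `8` all of
whose involutions are central, i.e. `G/N ≅ Q₈` with `c̄ = −1`. [folklore] -/
theorem isLeast_card_gfaces_generate_of_card_quotient_eight' (hG : IsPGroup 2 G) {c : G} (hc2 : c * c = 1) (hcen : ∀ x : G, x * c = c * x)
    (N : Subgroup G) [N.Normal] (hcN : c ∉ N) (hcardQ : Nat.card (G ⧸ N) = 8)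
    (h : (∀ a b : G ⧸ N, a * b = b * a) ∨ ∃ w : G, w ∉ N ∧ w * w ∈ N ∧ ∃ g : G, g * w * g⁻¹ * w⁻¹ ∉ N) :
    IsLeast {n : ℕ | ∃ T : Finset (CMF G c →₀ ℤ), (↑T ⊆ gfaceSet G c hc2) ∧ T.card = n ∧
      hodgeSpan c hc2 ≤ Submodule.span ℤ (pairSet c) ⊔ Submodule.span ℤ (translates c T)} (fibreTwo c hc2) := by
  rcases h with hcomm | ⟨w, hwN, hwwN, hwz⟩
  · exact CyclicCharacter.isLeast_card_gfaces_generate_fibreTwo_of_notMem_commutator hc2 hcen (notMem_commutator_of_quotient_comm N hcN hcomm)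
  · exact isLeast_card_gfaces_generate_of_card_quotient_eight hG hc2 hcen N hcN hcardQ w hwN hwwN hwz

end

end Summit.HodgeConjecture.CorCM.Census.CentralSquares
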